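import Summits.NavierStokesRegularity.FluidComputer.PalasekTowerBurgersCornerCore

/-!
# The Burgers child core LEVEL BY LEVEL: the model-faithful stretching line is TOWER-COMPATIBLE once the Burgers factor
# exceeds 14 — explicit endowments `(C, λ_k) = (3/2, (14/B_k)²)` pass all four level-(k+1) clauses at EVERY level —
# and on the registered (wide) rates this opens only at level 24 (crux `EpisodeBase` 19179 / heredity cruxes 19249–19250;
# kernel companion IV of the holder's RE-TUNING BRIEF v1.2c §9)

Cell `ns-blowup`, seat `ns-palasek-19179-p2` (g5). In ecbridge-8 g3's MODEL identification (p433323: the level-`(k+1)` child core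
read as `burgersVortex (λA_k) 1 (C·N_{k+1}^{β−2})`) and the brief's variable `B_k := N_k^{β/2−b}` (the Burgers factor,
increasing along every admissible tower and `→ ∞` by DC1, `palasekTowerBreakdown_tendsto_burgersFactor`), this file proves:

* §1–§2 (any rates, any level): `A_k/N_{k+1}² = B_k²`; on the RIM CIRCLE of the level-`(k+1)` core ball (radius `1/N_{k+1}`) the
  child core carries circulation `C·N_{k+1}^{β−2}·(1 − e^{−λB_k²/4})` (Saffman §13.1 via `circulation_burgersVortex_circleLoop`).
* §3 **LEVEL-UNIFORM ENDOWMENT**: if `B_k ≥ 14`, the child core with circulation `3/2 ×` its floor sitting in the strain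
  `λ_k·A_k`, `λ_k := (14/B_k)² ∈ (0, 1]` (so `C√λ_k·B_k = 21 ∈ [500π/79, 4√2π·3/2]`, `Cλ_k B_k² = 294 ≥ 8π`, `λ_kB_k² = 196 ≥ 8`),
  passes ALL FOUR level-`(k+1)` clauses: speed floor `Y_{k+1}`, soft ceiling `(3/2)Y_{k+1}`, strain floor `A_{k+1}`, core ledger
  (`c₁ = 1`) on the rim circle (`palasekTowerBreakdown_burgersLine_level`).
* §4 **TOWER COMPATIBILITY**: `B_k` is non-decreasing, so `B₀ ≥ 14` gives the level clause at EVERY `k`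
  (`palasekTowerBreakdown_burgersLine_allLevels`); in particular at the brief's corner `(2^23, 41/40, 12/5)` (`B₀ > 16.27`).
* §5 **THE REGISTERED RATES**: on `TowerRates.wide` `B_k = 2^{(2/5)(11/10)^k}`: `B₂₃ < 14 ≤ B₂₄` — the model's own stretching line
  becomes admissible (in this arithmetic) only from level `24` on (`N₂₄ = 256^{(11/10)^{24}} ≈ 10^{23.7}`), while items 19179 /
  19249 / 19250 ask for levels `1`, `2`, `≥ 3`.

LABEL: E–C / MODEL register arithmetic (KERNEL). WHAT THIS IS NOT: not Navier–Stokes evidence — exact infinite-energy profiles read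
against the register's letters; no registered stage; nothing about the truth of any crux; no re-tuning is proposed here (D-0014).

References: P. G. Saffman, *Vortex Dynamics* (CUP 1992) §13.1 (3)–(4) [cite: Saffman1992, §13.1 eq. (3)]; S. Palasek,
arXiv:2605.13827 §3 (3.2) [cite: Palasek2026ElementaryModel, §3 (3.2)].
-/

noncomputable section

namespace Summit.NavierStokesRegularity.FluidComputer.PalasekTowerClayBridge

open Real Set Metric Filter Topology
open Literature.Analysis.FluidPDE

/-! ## §1 The Burgers factor along the tower -/

namespace TowerRates

variable (R : TowerRates)

/-- `A_k/N_{k+1}² = N_k^{β−2b} = B_k²`. [cite: Palasek2026ElementaryModel, §3 (3.2)] -/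
theorem A_div_N_succ_sq (k : ℕ) : R.A k / R.N (k + 1) ^ 2 = R.N k ^ (R.β - 2 * R.b) := by
  have hN := R.N_pos k
  have h2 : R.N (k + 1) ^ 2 = R.N k ^ (2 * R.b) := by
    rw [R.N_succ k, ← Real.rpow_natCast, ← Real.rpow_mul hN.le]
    congr 1; push_cast; ring
  rw [h2, TowerRates.A, ← Real.rpow_sub hN]

/-- `B_k² = N_k^{β−2b}`. [folklore] -/
theorem burgersFactor_sq_level (k : ℕ) : (R.N k ^ (R.β / 2 - R.b)) ^ 2 = R.N k ^ (R.β - 2 * R.b) := by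
  rw [← Real.rpow_natCast, ← Real.rpow_mul (R.N_pos k).le]
  congr 1; push_cast; ring

/-- The Burgers factor is positive. [folklore] -/
theorem burgersFactor_pos (k : ℕ) : 0 < R.N k ^ (R.β / 2 - R.b) := Real.rpow_pos_of_pos (R.N_pos k) _

/-- **The Burgers factor is non-decreasing along the tower** (`N_k ≤ N_{k+1}`, exponent `β/2 − b > 0`). [folklore] -/
theorem burgersFactor_mono : Monotone fun k => R.N k ^ (R.β / 2 - R.b) := by
  refine monotone_nat_of_le_succ fun k => ?_
  exact Real.rpow_le_rpow (R.N_pos k).le (R.N_lt_N_succ k).le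
    (palasekTowerBreakdown_burgers_exponent_pos R).le

/-- Hence `B_k ≥ B₀` at every level. [folklore] -/
theorem burgersFactor_zero_le (k : ℕ) : R.N 0 ^ (R.β / 2 - R.b) ≤ R.N k ^ (R.β / 2 - R.b) :=
  R.burgersFactor_mono (Nat.zero_le k)

end TowerRates

/-! ## §2 The rim circle of the level-(k+1) core ball -/

/-- The rim circle of radius `1/N_{k+1}` stays in the core ball. [folklore] -/
theorem rimCircle_succ_mem_closedBall (R : TowerRates) (k : ℕ) (s : ℝ) :
    circleLoop (0 : EuclideanSpace ℝ (Fin 3)) (1 / R.N (k + 1)) (EuclideanSpace.single (0 : Fin 3) (1 : ℝ))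
        (EuclideanSpace.single (1 : Fin 3) (1 : ℝ)) s ∈
      closedBall (0 : EuclideanSpace ℝ (Fin 3)) (1 / R.N (k + 1)) := by
  rw [mem_closedBall, dist_zero_right, norm_circleLoop_axis, abs_of_pos (by have := R.N_pos (k + 1); positivity)]

/-- The rim circle's speed `2π/N_{k+1} ≤ 8π/N_{k+1}`. [folklore] -/
theorem norm_deriv_rimCircle_succ_le (R : TowerRates) (k : ℕ) (s : ℝ) :
    ‖deriv (circleLoop (0 : EuclideanSpace ℝ (Fin 3)) (1 / R.N (k + 1)) (EuclideanSpace.single (0 : Fin 3) (1 : ℝ))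
        (EuclideanSpace.single (1 : Fin 3) (1 : ℝ))) s‖ ≤ 8 * π / R.N (k + 1) := by
  have hN := R.N_pos (k + 1)
  rw [norm_deriv_circleLoop_axis, abs_of_pos (by positivity), le_div_iff₀ hN]
  have hπ := Real.pi_pos
  field_simp
  nlinarith

/-- **The child core's circulation on the rim circle at level `k+1`** (`λ > 0`, any `C`):
`∮ = C·N_{k+1}^{β−2}·(1 − e^{−λN_k^{β−2b}/4})`. [cite: Saffman1992, §13.1 eq. (3)] -/
theorem circulation_burgersChild_rimCircle_succ (R : TowerRates) (k : ℕ) {l : ℝ} (hl : 0 < l) (C : ℝ) :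
    circulation (burgersVortex (l * R.A k) 1 (C * R.N (k + 1) ^ (R.β - 2)))
        (circleLoop (0 : EuclideanSpace ℝ (Fin 3)) (1 / R.N (k + 1)) (EuclideanSpace.single (0 : Fin 3) (1 : ℝ))
          (EuclideanSpace.single (1 : Fin 3) (1 : ℝ))) =
      C * R.N (k + 1) ^ (R.β - 2) * (1 - Real.exp (-(l * R.N k ^ (R.β - 2 * R.b) / 4))) := by
  have hγ : l * R.A k ≠ 0 := (mul_pos hl (R.A_pos k)).ne'
  rw [circulation_burgersVortex_circleLoop hγ one_ne_zero]
  congr 3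
  rw [← R.A_div_N_succ_sq k]
  have hN := (R.N_pos (k + 1)).ne'
  field_simp

/-! ## §3 The level-uniform endowment `(C, λ_k) = (3/2, (14/B_k)²)` -/

/-- **ALL FOUR level-(k+1) CLAUSES for the Burgers child core at natural endowment, at ANY level with `B_k ≥ 14`.** With
`λ_k := (14/B_k)² ∈ (0, 1]` and circulation `(3/2)·N_{k+1}^{β−2}` in the strain `λ_k A_k` (`ν = 1`): speed floor `Y_{k+1}`
somewhere, soft ceiling `(3/2)Y_{k+1}` everywhere, strain floor `A_{k+1}` on the axis, and the core-ledger clause (`c₁ = 1`) on the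
rim circle of the core ball. [cite: Saffman1992, §13.1 eq. (4)] -/
theorem palasekTowerBreakdown_burgersLine_level (R : TowerRates) (k : ℕ) (hB : (14 : ℝ) ≤ R.N k ^ (R.β / 2 - R.b)) :
    ∃ l : ℝ, 0 < l ∧ l ≤ 1 ∧
      (∃ x : EuclideanSpace ℝ (Fin 3),
        1 * R.Y (k + 1) ≤ ‖burgersVortexSwirl (l * R.A k) 1 (3 / 2 * R.N (k + 1) ^ (R.β - 2)) x‖) ∧
      (∀ x : EuclideanSpace ℝ (Fin 3),
        ‖burgersVortexSwirl (l * R.A k) 1 (3 / 2 * R.N (k + 1) ^ (R.β - 2)) x‖ ≤ 3 / 2 * R.Y (k + 1)) ∧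
      (∃ x : EuclideanSpace ℝ (Fin 3),
        1 * R.A (k + 1) ≤ ‖fderiv ℝ (burgersVortex (l * R.A k) 1 (3 / 2 * R.N (k + 1) ^ (R.β - 2))) x‖) ∧
      (∃ (x' : EuclideanSpace ℝ (Fin 3)) (γ : ℝ → EuclideanSpace ℝ (Fin 3)),
        ‖x'‖ ≤ 0 ∧ ContDiff ℝ 1 γ ∧ γ 0 = γ 1 ∧
        (∀ s ∈ Icc (0 : ℝ) 1, γ s ∈ closedBall x' (1 / R.N (k + 1))) ∧
        (∀ s ∈ Icc (0 : ℝ) 1, ‖deriv γ s‖ ≤ 8 * π / R.N (k + 1)) ∧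
        1 * R.N (k + 1) ^ (R.β - 2) ≤ circulation (burgersVortex (l * R.A k) 1 (3 / 2 * R.N (k + 1) ^ (R.β - 2))) γ) := by
  set B : ℝ := R.N k ^ (R.β / 2 - R.b) with hBdef
  have hBpos : 0 < B := R.burgersFactor_pos k
  set l : ℝ := (14 / B) ^ 2 with hldef
  have hl : 0 < l := by positivity
  have hsqrt : Real.sqrt l = 14 / B := by rw [hldef, Real.sqrt_sq (by positivity)]
  have hP : (3 : ℝ) / 2 * Real.sqrt l * B = 21 := by rw [hsqrt]; field_simp; ring
  have hlB2 : l * R.N k ^ (R.β - 2 * R.b) = 196 := by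
    rw [← R.burgersFactor_sq_level k, ← hBdef, hldef]; field_simp; ring
  refine ⟨l, hl, ?_, ?_, ?_, ?_, ?_⟩
  · -- λ ≤ 1
    rw [hldef, div_pow, div_le_one (by positivity)]
    nlinarith
  · -- speed floor
    refine palasekTowerBreakdown_burgers_floor R k (by norm_num) hl ?_
    rw [hP]
    have := five_hundred_pi_div_79_le_twenty
    linarith
  · -- soft ceiling
    intro x
    refine palasekTowerBreakdown_burgers_noOvershoot R k (by norm_num) hl ?_ x
    rw [hP]
    have := four_sqrt_two_pi_gt
    nlinarith
  · -- strain floor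
    refine palasekTowerBreakdown_burgers_strainFloor_axis R k (by norm_num) hl ?_
    rw [show (3 : ℝ) / 2 * l * R.N k ^ (R.β - 2 * R.b) = 3 / 2 * (l * R.N k ^ (R.β - 2 * R.b)) by ring, hlB2]
    have := palasekTowerBreakdown_eight_pi_lt
    linarith
  · -- core ledger on the rim circle
    refine ⟨0, circleLoop (0 : EuclideanSpace ℝ (Fin 3)) (1 / R.N (k + 1)) (EuclideanSpace.single (0 : Fin 3) (1 : ℝ))
        (EuclideanSpace.single (1 : Fin 3) (1 : ℝ)), by simp, contDiff_circleLoop _ _ _ _, ?_,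
      fun s _ => rimCircle_succ_mem_closedBall R k s, fun s _ => norm_deriv_rimCircle_succ_le R k s, ?_⟩
    · have h := periodic_circleLoop (0 : EuclideanSpace ℝ (Fin 3)) (1 / R.N (k + 1))
        (EuclideanSpace.single (0 : Fin 3) (1 : ℝ)) (EuclideanSpace.single (1 : Fin 3) (1 : ℝ)) 0
      rw [zero_add] at h
      exact h.symm
    · rw [circulation_burgersChild_rimCircle_succ R k hl, hlB2]
      have hN : 0 < R.N (k + 1) ^ (R.β - 2) := Real.rpow_pos_of_pos (R.N_pos (k + 1)) _
      have hexp : Real.exp (-((196 : ℝ) / 4)) ≤ 1 / 3 := by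
        have h := Real.add_one_le_exp ((196 : ℝ) / 4)
        rw [Real.exp_neg]
        rw [inv_le_comm₀ (Real.exp_pos _) (by norm_num)]
        linarith
      nlinarith

/-! ## §4 Tower compatibility from the base factor -/

/-- **TOWER COMPATIBILITY OF THE MODEL LINE**: if the base Burgers factor `B₀ = N₀^{β/2−b} ≥ 14`, then at EVERY level `k` some
strain fraction `λ_k ∈ (0, 1]` makes the `(3/2)`-endowed Burgers child core pass all four level-`(k+1)` clauses (speed floor, soft
ceiling `3/2`, strain floor, core ledger). [cite: Saffman1992, §13.1 eq. (4)] -/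
theorem palasekTowerBreakdown_burgersLine_allLevels (R : TowerRates) (hB0 : (14 : ℝ) ≤ R.N 0 ^ (R.β / 2 - R.b)) (k : ℕ) :
    ∃ l : ℝ, 0 < l ∧ l ≤ 1 ∧
      (∃ x : EuclideanSpace ℝ (Fin 3),
        1 * R.Y (k + 1) ≤ ‖burgersVortexSwirl (l * R.A k) 1 (3 / 2 * R.N (k + 1) ^ (R.β - 2)) x‖) ∧
      (∀ x : EuclideanSpace ℝ (Fin 3),
        ‖burgersVortexSwirl (l * R.A k) 1 (3 / 2 * R.N (k + 1) ^ (R.β - 2)) x‖ ≤ 3 / 2 * R.Y (k + 1)) ∧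
      (∃ x : EuclideanSpace ℝ (Fin 3),
        1 * R.A (k + 1) ≤ ‖fderiv ℝ (burgersVortex (l * R.A k) 1 (3 / 2 * R.N (k + 1) ^ (R.β - 2))) x‖) ∧
      (∃ (x' : EuclideanSpace ℝ (Fin 3)) (γ : ℝ → EuclideanSpace ℝ (Fin 3)),
        ‖x'‖ ≤ 0 ∧ ContDiff ℝ 1 γ ∧ γ 0 = γ 1 ∧
        (∀ s ∈ Icc (0 : ℝ) 1, γ s ∈ closedBall x' (1 / R.N (k + 1))) ∧
        (∀ s ∈ Icc (0 : ℝ) 1, ‖deriv γ s‖ ≤ 8 * π / R.N (k + 1)) ∧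
        1 * R.N (k + 1) ^ (R.β - 2) ≤ circulation (burgersVortex (l * R.A k) 1 (3 / 2 * R.N (k + 1) ^ (R.β - 2))) γ) :=
  palasekTowerBreakdown_burgersLine_level R k (hB0.trans (R.burgersFactor_zero_le k))

/-- **The corner is tower-compatible**: every rates record with `(N₀, b, β) = (2^23, 41/40, 12/5)` has `B₀ > 16.27 ≥ 14`, so the
level clause holds at every `k`. [cite: Saffman1992, §13.1 eq. (4)] -/
theorem palasekTowerBreakdown_burgersCorner_allLevels (R : TowerRates) (hN : R.N₀ = 2 ^ 23) (hb : R.b = 41 / 40)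
    (hβ : R.β = 12 / 5) (k : ℕ) :
    ∃ l : ℝ, 0 < l ∧ l ≤ 1 ∧
      (∃ x : EuclideanSpace ℝ (Fin 3),
        1 * R.Y (k + 1) ≤ ‖burgersVortexSwirl (l * R.A k) 1 (3 / 2 * R.N (k + 1) ^ (R.β - 2)) x‖) ∧
      (∀ x : EuclideanSpace ℝ (Fin 3),
        ‖burgersVortexSwirl (l * R.A k) 1 (3 / 2 * R.N (k + 1) ^ (R.β - 2)) x‖ ≤ 3 / 2 * R.Y (k + 1)) ∧
      (∃ x : EuclideanSpace ℝ (Fin 3),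
        1 * R.A (k + 1) ≤ ‖fderiv ℝ (burgersVortex (l * R.A k) 1 (3 / 2 * R.N (k + 1) ^ (R.β - 2))) x‖) ∧
      (∃ (x' : EuclideanSpace ℝ (Fin 3)) (γ : ℝ → EuclideanSpace ℝ (Fin 3)),
        ‖x'‖ ≤ 0 ∧ ContDiff ℝ 1 γ ∧ γ 0 = γ 1 ∧
        (∀ s ∈ Icc (0 : ℝ) 1, γ s ∈ closedBall x' (1 / R.N (k + 1))) ∧
        (∀ s ∈ Icc (0 : ℝ) 1, ‖deriv γ s‖ ≤ 8 * π / R.N (k + 1)) ∧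
        1 * R.N (k + 1) ^ (R.β - 2) ≤ circulation (burgersVortex (l * R.A k) 1 (3 / 2 * R.N (k + 1) ^ (R.β - 2))) γ) :=
  palasekTowerBreakdown_burgersLine_allLevels R
    (by have := (palasekTowerBreakdown_burgersCorner_factor_bounds R hN hb hβ).1; linarith) k

/-! ## §5 The registered rates: the line opens only at level 24 -/

/-- On the wide rates `B_k = 2^{(2/5)·(11/10)^k}`. [folklore] -/
theorem palasekTowerBreakdown_burgersWide_factor_level (k : ℕ) :
    TowerRates.wide.N k ^ (TowerRates.wide.β / 2 - TowerRates.wide.b) = (2 : ℝ) ^ ((2 : ℝ) / 5 * (11 / 10 : ℝ) ^ k) := by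
  rw [palasekTowerBreakdown_burgers_exponent_wide]
  have hN : TowerRates.wide.N k = (2 : ℝ) ^ ((8 : ℝ) * (11 / 10 : ℝ) ^ k) := by
    show (256 : ℝ) ^ ((11 / 10 : ℝ) ^ k) = (2 : ℝ) ^ ((8 : ℝ) * (11 / 10 : ℝ) ^ k)
    rw [show (256 : ℝ) = (2 : ℝ) ^ (8 : ℝ) by norm_num, ← Real.rpow_mul (by norm_num : (0 : ℝ) ≤ 2)]
  rw [hN, ← Real.rpow_mul (by norm_num : (0 : ℝ) ≤ 2)]
  congr 1
  ring

/-- **Level 23 of the wide rates is still below the line's threshold**: `B₂₃ < 14` (`(2/5)(11/10)^{23} < 3.6 < log₂ 14`).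
[folklore] -/
theorem palasekTowerBreakdown_burgersWide_factor_23_lt :
    TowerRates.wide.N 23 ^ (TowerRates.wide.β / 2 - TowerRates.wide.b) < 14 := by
  rw [palasekTowerBreakdown_burgersWide_factor_level]
  have hexp : (2 : ℝ) / 5 * (11 / 10 : ℝ) ^ 23 < 18 / 5 := by norm_num
  calc (2 : ℝ) ^ ((2 : ℝ) / 5 * (11 / 10 : ℝ) ^ 23) < (2 : ℝ) ^ ((18 : ℝ) / 5) :=
        Real.rpow_lt_rpow_of_exponent_lt (by norm_num) hexp
    _ < 14 := TowerRates.two_rpow_lt_of_pow_lt (by norm_num) (a := 18) (m := 1) (r := 5) (by norm_num) (by norm_num)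

/-- **Level 24 of the wide rates clears it**: `14 ≤ B₂₄` (`(2/5)(11/10)^{24} > 3.9 > log₂ 14`). [folklore] -/
theorem palasekTowerBreakdown_burgersWide_factor_24_ge :
    (14 : ℝ) ≤ TowerRates.wide.N 24 ^ (TowerRates.wide.β / 2 - TowerRates.wide.b) := by
  rw [palasekTowerBreakdown_burgersWide_factor_level]
  have hexp : (39 : ℝ) / 10 < (2 : ℝ) / 5 * (11 / 10 : ℝ) ^ 24 := by norm_num
  have h1 : (14 : ℝ) < (2 : ℝ) ^ ((39 : ℝ) / 10) :=
    TowerRates.lt_two_rpow_of_pow_lt (a := 39) (m := 1) (r := 10) (by norm_num) (by norm_num)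
  have h2 : (2 : ℝ) ^ ((39 : ℝ) / 10) < (2 : ℝ) ^ ((2 : ℝ) / 5 * (11 / 10 : ℝ) ^ 24) :=
    Real.rpow_lt_rpow_of_exponent_lt (by norm_num) hexp
  exact (h1.trans h2).le

/-- **On the registered rates the model line is admissible (in this arithmetic) from level `24` on**: at every `k ≥ 24` the
`(3/2)`-endowed Burgers child core passes all four level-`(k+1)` clauses for some `λ_k ∈ (0, 1]`. (Items 19179 / 19249 / 19250 ask for
levels `1`, `2`, `≥ 3`; at `k = 0` the companion p513535 shows every `C√λ ≤ 13` misses the speed floor.) [cite: Saffman1992, §13.1 eq. (4)] -/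
theorem palasekTowerBreakdown_burgersWide_line_from_24 (k : ℕ) (hk : 24 ≤ k) :
    ∃ l : ℝ, 0 < l ∧ l ≤ 1 ∧
      (∃ x : EuclideanSpace ℝ (Fin 3),
        1 * TowerRates.wide.Y (k + 1) ≤
          ‖burgersVortexSwirl (l * TowerRates.wide.A k) 1 (3 / 2 * TowerRates.wide.N (k + 1) ^ (TowerRates.wide.β - 2)) x‖) ∧
      (∀ x : EuclideanSpace ℝ (Fin 3),
        ‖burgersVortexSwirl (l * TowerRates.wide.A k) 1 (3 / 2 * TowerRates.wide.N (k + 1) ^ (TowerRates.wide.β - 2)) x‖ ≤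
          3 / 2 * TowerRates.wide.Y (k + 1)) ∧
      (∃ x : EuclideanSpace ℝ (Fin 3),
        1 * TowerRates.wide.A (k + 1) ≤
          ‖fderiv ℝ (burgersVortex (l * TowerRates.wide.A k) 1 (3 / 2 * TowerRates.wide.N (k + 1) ^ (TowerRates.wide.β - 2))) x‖) ∧
      (∃ (x' : EuclideanSpace ℝ (Fin 3)) (γ : ℝ → EuclideanSpace ℝ (Fin 3)),
        ‖x'‖ ≤ 0 ∧ ContDiff ℝ 1 γ ∧ γ 0 = γ 1 ∧
        (∀ s ∈ Icc (0 : ℝ) 1, γ s ∈ closedBall x' (1 / TowerRates.wide.N (k + 1))) ∧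
        (∀ s ∈ Icc (0 : ℝ) 1, ‖deriv γ s‖ ≤ 8 * π / TowerRates.wide.N (k + 1)) ∧
        1 * TowerRates.wide.N (k + 1) ^ (TowerRates.wide.β - 2) ≤
          circulation (burgersVortex (l * TowerRates.wide.A k) 1 (3 / 2 * TowerRates.wide.N (k + 1) ^ (TowerRates.wide.β - 2))) γ) :=
  palasekTowerBreakdown_burgersLine_level TowerRates.wide k
    (palasekTowerBreakdown_burgersWide_factor_24_ge.trans (TowerRates.wide.burgersFactor_mono hk))

end Summit.NavierStokesRegularity.FluidComputer.PalasekTowerClayBridge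

end
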